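import Summits.NavierStokesRegularity.NavierStokesRegularity.Theorems.WakeRatchetEternalInviscidRateStubNoConveyor
import Summits.NavierStokesRegularity.NavierStokesRegularity.Theorems.WakeRatchetEternalInviscidRateStubWakeLimit
import Summits.NavierStokesRegularity.NavierStokesRegularity.Theorems.WakeRatchetEternalInviscidRateStubTailLimit

/-!
# Conveyor ledger (crux `WakeRatchet.EternalInviscidRate`, ⟨stmt-NavierStokesRegularity-25646⟩) —
# the COMPOSITION of the registered skeleton IN THE TREE, with general budgets `(γ, κ)`

The skeleton of record «conveyor ledger» (LINE g10-3, `conveyor_ledger_line.lean`, sha16 `d183ebc25b56`, namespace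
`…Cruxes.EternalInviscidRate.FinalWakeLedger`) composes the crux `EternalInviscidRate` from five stubs.  Three are landed BY NAME
(`stub_wakeLimit` p818315, `stub_tailLimit` p818324, `stub_noConveyor` p817326); the two open ones are the sloshing budget
`stub_noSloshing : ∀ R ≥ 1, NoSloshing R (1/6)` and the heart `stub_wakeFloor : ∀ R ≥ 1, ∃ κ < 1/2, WakeFloor R κ`.  Until now the
composition `EternalInviscidRate_of` lived only in the planner's folder.  This file puts it in the tree, with the three landed stubs
DISCHARGED and the two budgets made PARAMETERS:

* `tail_succ_le_of_budgets` — the one-solution ledger: no conveyor mass at shells `n`, `n+1`, a sloshing factor `s` at shell `n+1`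
  (`T_{n+1}(σ) ≤ s·T(n+1)` for all `σ`) and a wake-floor factor `q` at shell `n` (`Σ_{k<K} ω(n+1+k) ≤ q·Σ_{k<K+1} ω(n+k)` for all `K`)
  turn a bound `M` on the tail above `n` into the bound `s·q·M` on the tail above `n+1`.
* `EternalInviscidRate_of_budgets` — **the crux BY NAME** from: for every `R ≥ 1` SOME pair of budgets `γ, κ` with `γ + κ < 2/3` such that
  the inner statements of `NoSloshing R γ` and `WakeFloor R κ` hold (written out; the tree carries no such defs).  Exponent `a = 5/3 − κ − γ`.
  The three landed stubs are used by name; no smallness of `ε₀` beyond the budgets' own `εs`.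
* `EternalInviscidRate_of_open_stubs` — the registered composition verbatim: the statements of the two OPEN stubs (`γ = 1/6`, `κ < 1/2`)
  imply the crux BY NAME (`a = 3/2 − κ`).  If both ever land under their registered names, the crux closes by a three-line file.
READING (repair census, kernel form).  The conveyor-ledger FAMILY of lines is exactly `{(γ, κ) : γ + κ < 2/3}`; instrument E-g10-2
(evidence RESULT-E-g10-2.md on ⟨25646⟩, kit j320471/j321929) reads the sloshing lift `ℓ ≈ 2.9` (`γ ≥ 2.9` needed) on the certified table
`tao2rot ∈ E₂(4)`, and E-g10-1 reads the front exponent `a_front → 5/3` (`κ → 0⁺`), so NO member of the family is consistent with those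
readings — the line is numerically dead in all its `(γ, κ)` repairs while the crux itself (`a_front ≈ 5/3 > 1`) is not touched by them.
HONEST LABEL: bookkeeping; no registered stub is closed here; the crux `EternalInviscidRate` and every NS statement remain OPEN.  MODEL
lattice only (Tao 2016 §4 renormalised cascade); nothing here bears on the summit.
[cite: Tao2016AveragedNS, §4 Lemma 4.1 (4.8)–(4.10) with the cancellation (4.3), in the self-similar variables of §6.4]
-/

noncomputable section

set_option linter.dupNamespace false

open Filter Topology
open Literature.Analysis.FluidPDE.TaoCascade

namespace Summit.NavierStokesRegularity.NavierStokesRegularity.Cruxes.EternalInviscidRate.FinalWakeLedger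

/-- **The one-solution ledger with general budgets.**  For a uniformly bounded family `W` (`ε₀ > 0`) with final wakes `ω` and final
tails `T` (supplied by hypothesis), NO CONVEYOR MASS at shells `n` and `n+1`, a SLOSHING FACTOR `s ≥ 0` at shell `n+1` and a WAKE-FLOOR
FACTOR `q ≥ 0` at shell `n`: a bound `M` on the tail above `n` at all log-times gives the bound `s·q·M` on the tail above `n+1` at all
log-times.  (`T_{n+1}(σ) ≤ s·T(n+1) = s·Σω(n+1+k) ≤ s·q·Σω(n+k) = s·q·T(n) ≤ s·q·M`.)  MODEL lattice only.
[cite: Tao2016AveragedNS, §4 Lemma 4.1 (4.8)–(4.10), §6.4; cell vocabulary (LINE g10-3 «conveyor ledger»)] -/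
theorem tail_succ_le_of_budgets {m : ℕ} {ε₀ : ℝ} (hε : 0 < ε₀) {W : ℤ → ℝ → Em m} (hU : UniformBound W)
    {ω : ℤ → ℝ} (hω : ∀ k : ℤ, Tendsto (physEnergy ε₀ W k) atTop (𝓝 (ω k)))
    {T : ℤ → ℝ} (hT : ∀ n : ℤ, Tendsto (fun σ => ∑' k : ℕ, physEnergy ε₀ W (n + k) σ) atTop (𝓝 (T n)))
    {n : ℤ} (hCn : T n = ∑' k : ℕ, ω (n + k)) (hCn1 : T (n + 1) = ∑' k : ℕ, ω (n + 1 + k))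
    {s q : ℝ} (hs : 0 ≤ s) (hq : 0 ≤ q)
    (hslosh : ∀ σ : ℝ, ∑' k : ℕ, physEnergy ε₀ W (n + 1 + k) σ ≤ s * T (n + 1))
    (hfloor : ∀ K : ℕ, ∑ k ∈ Finset.range K, ω (n + 1 + k) ≤ q * ∑ k ∈ Finset.range (K + 1), ω (n + k))
    {M : ℝ} (hM : ∀ σ : ℝ, ∑' k : ℕ, physEnergy ε₀ W (n + k) σ ≤ M) (σ : ℝ) :
    ∑' k : ℕ, physEnergy ε₀ W (n + 1 + k) σ ≤ s * q * M := by
  have hS : ∀ (j : ℤ) (σ' : ℝ), Summable (fun k : ℕ => physEnergy ε₀ W (j + k) σ') :=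
    fun j σ' => summable_physEnergy_tail_cm hε hU j σ'
  have hω0 : ∀ k : ℤ, 0 ≤ ω k := fun k => finalWake_nonneg hω k
  have hTM : T n ≤ M := le_of_tendsto' (hT n) fun σ' => hM σ'
  have hωs : Summable (fun k : ℕ => ω (n + k)) := finalWake_summable hS hω hT n
  -- the wake floor, passed to infinite sums
  have hfl : ∑' k : ℕ, ω (n + 1 + k) ≤ q * ∑' k : ℕ, ω (n + k) := by
    refine Real.tsum_le_of_sum_range_le (fun k => hω0 _) fun K => ?_
    refine (hfloor K).trans (mul_le_mul_of_nonneg_left ?_ hq)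
    exact hωs.sum_le_tsum (Finset.range (K + 1)) fun k _ => hω0 _
  calc ∑' k : ℕ, physEnergy ε₀ W (n + 1 + k) σ
      ≤ s * T (n + 1) := hslosh σ
    _ = s * ∑' k : ℕ, ω (n + 1 + k) := by rw [hCn1]
    _ ≤ s * (q * ∑' k : ℕ, ω (n + k)) := mul_le_mul_of_nonneg_left hfl hs
    _ = s * q * T n := by rw [hCn]; ring
    _ ≤ s * q * M := mul_le_mul_of_nonneg_left hTM (mul_nonneg hs hq)

/-- **The crux BY NAME from a pair of budgets `γ + κ < 2/3`.**  Suppose that for every spread `R ≥ 1` there are budgets `γ, κ` with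
`γ + κ < 2/3` and a threshold `εs > 0` below which, for every table of `E₂(R)` and every uniformly bounded admissible inviscid eternal
solution with final tails `T` and final wakes `ω`: (NO SLOSHING, budget `γ`) `T_n(σ) ≤ (1+ε₀)^γ·T(n)` for all `n, σ`, and (WAKE FLOOR,
defect `κ`) `Σ_{k<K} ω(n+1+k) ≤ (1+ε₀)^{κ−5/3}·Σ_{k<K+1} ω(n+k)` for all `n, K`.  Then `WakeRatchet.EternalInviscidRate` holds with
`a = 5/3 − κ − γ > 1`.  The landed stubs `stub_wakeLimit`, `stub_tailLimit`, `stub_noConveyor` supply the wakes, the tails and the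
tightness.  MODEL lattice only; the hypothesis is NOT supplied by the tree.
[cite: Tao2016AveragedNS, §4 Lemma 4.1 (4.8)–(4.10) with (4.3), §6.4; cell vocabulary (LINE g10-3 «conveyor ledger»)] -/
theorem EternalInviscidRate_of_budgets
    (h : ∀ R : ℝ, 1 ≤ R → ∃ γ κ : ℝ, γ + κ < 2 / 3 ∧ ∃ εs : ℝ, 0 < εs ∧ ∀ ε₀ : ℝ, 0 < ε₀ → ε₀ ≤ εs →
      ∀ α : Fin 4 → Fin 4 → Fin 4 → ℤ × ℤ × ℤ → ℝ, InTableClass R α →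
      ∀ W : ℤ → ℝ → Em 4, IsEternal ε₀ α W → UniformBound W →
      (∀ T : ℤ → ℝ, (∀ n : ℤ, Tendsto (fun σ => ∑' k : ℕ, physEnergy ε₀ W (n + k) σ) atTop (𝓝 (T n))) →
        ∀ (n : ℤ) (σ : ℝ), ∑' k : ℕ, physEnergy ε₀ W (n + k) σ ≤ (1 + ε₀) ^ γ * T n) ∧
      (∀ ω : ℤ → ℝ, (∀ k : ℤ, Tendsto (physEnergy ε₀ W k) atTop (𝓝 (ω k))) →
        ∀ (n : ℤ) (K : ℕ), ∑ k ∈ Finset.range K, ω (n + 1 + k) ≤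
          (1 + ε₀) ^ (κ - 5 / 3) * ∑ k ∈ Finset.range (K + 1), ω (n + k))) :
    Summit.NavierStokesRegularity.NavierStokesRegularity.Theses.WakeRatchet.EternalInviscidRate := by
  intro R hR
  obtain ⟨γ, κ, hγκ, ε₁, hε₁, H⟩ := h R hR
  obtain ⟨ε₃, hε₃, H₃⟩ := stub_noConveyor R hR
  refine ⟨5 / 3 - κ - γ, by linarith, min ε₁ ε₃, lt_min hε₁ hε₃, ?_⟩
  intro ε₀ hε₀ hle α hα W hW hU n M hM σ
  have hle₁ : ε₀ ≤ ε₁ := hle.trans (min_le_left _ _)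
  have hle₃ : ε₀ ≤ ε₃ := hle.trans (min_le_right _ _)
  have h1ε : 0 < 1 + ε₀ := by linarith
  -- final wakes and final tails (landed stubs)
  choose ω hω using stub_wakeLimit ε₀ hε₀ α hα.2.1 W hW
  choose T hT using stub_tailLimit ε₀ hε₀ α hα.2.1 W hW hU
  obtain ⟨Hs, Hf⟩ := H ε₀ hε₀ hle₁ α hα W hW hU
  -- no conveyor mass (landed stub)
  have hCn : T n = ∑' k : ℕ, ω (n + k) := H₃ ε₀ hε₀ hle₃ α hα W hW hU ω hω T hT n
  have hCn1 : T (n + 1) = ∑' k : ℕ, ω (n + 1 + k) := H₃ ε₀ hε₀ hle₃ α hα W hW hU ω hω T hT (n + 1)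
  have key := tail_succ_le_of_budgets hε₀ hU hω hT hCn hCn1 (Real.rpow_nonneg h1ε.le γ)
    (Real.rpow_nonneg h1ε.le (κ - 5 / 3)) (fun σ' => Hs T hT (n + 1) σ') (fun K => Hf ω hω n K) hM σ
  have hexp : (1 + ε₀) ^ γ * (1 + ε₀) ^ (κ - 5 / 3) = (1 + ε₀) ^ (-(5 / 3 - κ - γ)) := by
    rw [← Real.rpow_add h1ε]; congr 1; ring
  rwa [hexp] at key

/-- **The registered composition, in the tree.**  The statements of the two OPEN stubs of the skeleton of record d183ebc25b56 —
`stub_noSloshing` (`∀ R ≥ 1, NoSloshing R (1/6)`, written out) and `stub_wakeFloor` (`∀ R ≥ 1, ∃ κ < 1/2, WakeFloor R κ`, written out) —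
imply the crux `WakeRatchet.EternalInviscidRate` BY NAME (`a = 3/2 − κ`; the three other stubs are landed and used by name).
Nothing is claimed about the truth of the two hypotheses (instrument E-g10-2 reads the first as numerically false on `tao2rot ∈ E₂(4)`).
MODEL lattice only.  [cite: Tao2016AveragedNS, §4 Lemma 4.1 (4.8)–(4.10) with (4.3), §6.4; cell vocabulary (LINE g10-3)] -/
theorem EternalInviscidRate_of_open_stubs
    (h₄ : ∀ R : ℝ, 1 ≤ R → ∃ εs : ℝ, 0 < εs ∧ ∀ ε₀ : ℝ, 0 < ε₀ → ε₀ ≤ εs →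
      ∀ α : Fin 4 → Fin 4 → Fin 4 → ℤ × ℤ × ℤ → ℝ, InTableClass R α →
      ∀ W : ℤ → ℝ → Em 4, IsEternal ε₀ α W → UniformBound W →
      ∀ T : ℤ → ℝ, (∀ n : ℤ, Tendsto (fun σ => ∑' k : ℕ, physEnergy ε₀ W (n + k) σ) atTop (𝓝 (T n))) →
      ∀ (n : ℤ) (σ : ℝ), ∑' k : ℕ, physEnergy ε₀ W (n + k) σ ≤ (1 + ε₀) ^ ((1 : ℝ) / 6) * T n)
    (h₅ : ∀ R : ℝ, 1 ≤ R → ∃ κ : ℝ, κ < 1 / 2 ∧ ∃ εs : ℝ, 0 < εs ∧ ∀ ε₀ : ℝ, 0 < ε₀ → ε₀ ≤ εs →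
      ∀ α : Fin 4 → Fin 4 → Fin 4 → ℤ × ℤ × ℤ → ℝ, InTableClass R α →
      ∀ W : ℤ → ℝ → Em 4, IsEternal ε₀ α W → UniformBound W →
      ∀ ω : ℤ → ℝ, (∀ k : ℤ, Tendsto (physEnergy ε₀ W k) atTop (𝓝 (ω k))) →
      ∀ (n : ℤ) (K : ℕ), ∑ k ∈ Finset.range K, ω (n + 1 + k) ≤
        (1 + ε₀) ^ (κ - 5 / 3) * ∑ k ∈ Finset.range (K + 1), ω (n + k)) :
    Summit.NavierStokesRegularity.NavierStokesRegularity.Theses.WakeRatchet.EternalInviscidRate := by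
  refine EternalInviscidRate_of_budgets fun R hR => ?_
  obtain ⟨ε₄, hε₄, H₄⟩ := h₄ R hR
  obtain ⟨κ, hκ, ε₅, hε₅, H₅⟩ := h₅ R hR
  refine ⟨1 / 6, κ, by linarith, min ε₄ ε₅, lt_min hε₄ hε₅, fun ε₀ hε₀ hle α hα W hW hU => ⟨?_, ?_⟩⟩
  · exact fun T hT n σ => H₄ ε₀ hε₀ (hle.trans (min_le_left _ _)) α hα W hW hU T hT n σ
  · exact fun ω hω n K => H₅ ε₀ hε₀ (hle.trans (min_le_right _ _)) α hα W hW hU ω hω n K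

end Summit.NavierStokesRegularity.NavierStokesRegularity.Cruxes.EternalInviscidRate.FinalWakeLedger

end
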